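import Summits.PneNP.PneNP.Theorems.ExpanderLinearGeneratorsDepthSevenToolkit
import Summits.PneNP.PneNP.Theorems.ExpanderLinearGeneratorsLinearGeneratorModPFregeHardCalibration

/-!
# PneNP / ExpanderLinearGenerators — depth-`7` refutations: conjunction elimination and the node
formulas of the decision tree (stmt-PneNP-11442 / 11443 / 11444, depth threshold)

Route `PneNP/ExpanderLinearGenerators`. Second of three files proving that every unsatisfiable CNF
has a `textbookFrege` refutation all of whose lines have alternation depth `≤ 7`
(`exists_isDepthProofOf_seven_neg_ofCNF`, file `…DepthSevenCompleteness`), which makes the depth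
threshold `d ≥ 7` of the three Frege rungs of the route exact (no proof of the target exists for
`d ≤ 6` by `seven_le_of_isDepthProofOf_neg_ofCNF`). Everything is budgeted at disjunct depth
`dd ≤ 6` with the size-free rules `DD.*` of `…DepthSevenToolkit` for the predicate
`∃ B ℓ, BD 6 B ℓ φ`:

* `conjExtract` — `⊢ ¬⋀M ∨ A` for a member `A` of a list conjunction `⋀M` of formulas of disjunct
  depth `≤ 1` (clause formulas), using the `∧`-axiom only at the spine pairs `(X, ⋀M')` — its
  second disjunct `¬(¬X ∨ ¬⋀M')` has `dd = 6`, the one tight line — and `¬¬`-introduction on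
  `¬X ∨ ¬⋀M'`;
* node formulas `g₁ ∨ (g₂ ∨ ⋯ (g_k ∨ ¬Φ)) = G.foldr disj ¬Φ` (falsified literals first, the
  target LAST, no `⊥` terminator): member introduction `memberIntro_target` / `memberIntro_lit`
  costs `dd ≤ 6` because the only deep member `¬Φ` (`dd = 4`) is a negation (`dd ¬¬Φ = 4`);
* `absorb_clause`, `leaf_of_clause` — from `⊢ ¬Φ ∨ C` for a clause `C` whose literals occur in
  the node formula, derive the node formula (cuts against member introductions, `assoc'`,
  generalized contraction, removal of the trailing `⊥`).

References: J. R. Shoenfield, *Mathematical Logic* (1967), §3.1 (tautology theorem, Lemma 2);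
R. E. Hodel, *An Introduction to Mathematical Logic* (1995), Ch. 3; J. Krajíček, *Bounded
arithmetic, propositional logic, and complexity theory* (CUP 1995), §4.3. Folklore.
-/

namespace Summit.PneNP.PneNP.Theorems

set_option linter.dupNamespace false -- `Summit.PneNP.PneNP.…`: summit = sub-problem (D-0017)

open Literature.Computability.Complexity Literature.Computability.Complexity.PropForm
open Literature.Computability.MetaComplexity Literature.Computability.MetaComplexity.TextbookFrege
open Literature.Computability.MetaComplexity.KEval (litForm clauseForm clauseForm_cons ofCNF_cons)

/-! ### Depth facts for literals, clauses and list conjunctions of clauses -/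

/-- A literal formula has disjunct depth `≤ 1`. [folklore] -/
theorem dd_litForm_le (l : Literal ℕ) : (litForm l).dd ≤ 1 :=
  altDepthAux_litForm_le 3 l

/-- A clause formula has disjunct depth `≤ 1`. [folklore] -/
theorem dd_clauseForm_le (c : Clause ℕ) : (clauseForm c).dd ≤ 1 := by
  induction c with
  | nil => simp [clauseForm]
  | cons l c ih =>
    rw [clauseForm_cons, dd_disj, max_le_iff]
    exact ⟨dd_litForm_le l, ih⟩

/-- Negating a formula costs at most two levels of disjunct depth. [folklore] -/
theorem dd_neg_le_dd_add_two (a : PropForm ℕ) : (neg a).dd ≤ a.dd + 2 := by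
  rw [dd_neg]
  have := altDepthAux_le_dd_succ 1 a
  omega

/-- Double negations form one block: `dd ¬¬a = dd ¬a`. [folklore] -/
theorem dd_neg_neg (a : PropForm ℕ) : (neg (neg a)).dd = (neg a).dd := by
  simp [dd_neg]

section ConjExtract

variable {M : List (PropForm ℕ)} {A X : PropForm ℕ}

/-- If all members have disjunct depth `≤ 1` then `dd ¬⋀M ≤ 4`. [folklore] -/
theorem dd_neg_conjList_le_four (hM : ∀ Y ∈ M, Y.dd ≤ 1) : (neg (conjList M)).dd ≤ 4 :=
  dd_neg_conjList_le hM

/-- If all members have disjunct depth `≤ 1` then `dd ⋀M ≤ 3`. [folklore] -/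
theorem dd_conjList_le_three (hM : ∀ Y ∈ M, Y.dd ≤ 1) : (conjList M).dd ≤ 3 :=
  dd_conjList_le hM

/-- **Conjunction elimination at disjunct depth `6`, head case**: `⊢ ¬(X ∧ ⋀M) ∨ X` when `X` and
the members of `M` have disjunct depth `≤ 1`. Lines: the `∧`-axiom
`¬(X ∧ ⋀M) ∨ ¬(¬X ∨ ¬⋀M)` (second disjunct of `dd = 6`), commuted; `(¬X ∨ ¬⋀M) ∨ X` from the
axiom `¬X ∨ X` by generalized expansion and associativity; `¬¬(¬X ∨ ¬⋀M) ∨ X` by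
`¬¬`-introduction; cut. [Shoenfield 1967, §3.1; Hodel 1995, p. 100] [folklore] -/
theorem conjExtract_head (hX : X.dd ≤ 1) (hM : ∀ Y ∈ M, Y.dd ≤ 1) :
    ∃ B ℓ, BD 6 B ℓ (disj (neg (conj X (conjList M))) X) := by
  have hXM : ∀ Y ∈ X :: M, Y.dd ≤ 1 := by
    intro Y hY
    rcases List.mem_cons.1 hY with rfl | hY
    · exact hX
    · exact hM Y hY
  have h1 : (neg (conjList (X :: M))).dd ≤ 4 := dd_neg_conjList_le_four hXM
  rw [conjList_cons] at h1
  have h2 : (neg (conjList M)).dd ≤ 4 := dd_neg_conjList_le_four hM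
  have h3 : (neg X).dd ≤ 3 := (dd_neg_le_dd_add_two X).trans (by omega)
  have h4 : (conjList M).dd ≤ 3 := dd_conjList_le_three hM
  -- the `∧`-axiom, commuted
  have L1 : ∃ B ℓ, BD 6 B ℓ (disj (neg (conj X (conjList M)))
      (neg (disj (neg X) (neg (conjList M))))) := by
    refine DD.conjAx₁ X (conjList M) ?_
    rw [dd_disj, max_le_iff]
    refine ⟨by omega, ?_⟩
    rw [dd_neg, altDepthAux_one_disj]
    omega
  have L2 : ∃ B ℓ, BD 6 B ℓ (disj (neg (disj (neg X) (neg (conjList M))))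
      (neg (conj X (conjList M)))) := DD.comm L1 (by rw [dd_neg_neg]; exact h1.trans (by omega))
  -- `(¬X ∨ ¬⋀M) ∨ X`
  have L3 : ∃ B ℓ, BD 6 B ℓ (disj (disj (neg X) (neg (conjList M))) X) := by
    refine DD.assoc (DD.genExp (neg (conjList M)) (DD.ax X ?_) ?_ ?_ ?_)
    · rw [dd_disj]; exact max_le (h3.trans (by omega)) (hX.trans (by omega))
    · rw [dd_neg_neg]; omega
    · omega
    · omega
  -- `¬¬(¬X ∨ ¬⋀M) ∨ X`
  have L4 : ∃ B ℓ, BD 6 B ℓ (disj (neg (neg (disj (neg X) (neg (conjList M))))) X) := by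
    refine DD.negNeg L3 ?_ (h3.trans (by omega))
    rw [dd_neg, altDepthAux_one_disj]
    omega
  exact DD.cut L2 L4

/-- **Conjunction elimination at disjunct depth `6`, tail case**: `⊢ ¬(X ∧ ⋀M) ∨ ⋀M`.
[Shoenfield 1967, §3.1; Hodel 1995, p. 100] [folklore] -/
theorem conjExtract_tail (hX : X.dd ≤ 1) (hM : ∀ Y ∈ M, Y.dd ≤ 1) :
    ∃ B ℓ, BD 6 B ℓ (disj (neg (conj X (conjList M))) (conjList M)) := by
  have hXM : ∀ Y ∈ X :: M, Y.dd ≤ 1 := by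
    intro Y hY
    rcases List.mem_cons.1 hY with rfl | hY
    · exact hX
    · exact hM Y hY
  have h1 : (neg (conjList (X :: M))).dd ≤ 4 := dd_neg_conjList_le_four hXM
  rw [conjList_cons] at h1
  have h2 : (neg (conjList M)).dd ≤ 4 := dd_neg_conjList_le_four hM
  have h3 : (neg X).dd ≤ 3 := (dd_neg_le_dd_add_two X).trans (by omega)
  have h4 : (conjList M).dd ≤ 3 := dd_conjList_le_three hM
  have L1 : ∃ B ℓ, BD 6 B ℓ (disj (neg (conj X (conjList M)))
      (neg (disj (neg X) (neg (conjList M))))) := by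
    refine DD.conjAx₁ X (conjList M) ?_
    rw [dd_disj, max_le_iff]
    refine ⟨by omega, ?_⟩
    rw [dd_neg, altDepthAux_one_disj]
    omega
  have L2 : ∃ B ℓ, BD 6 B ℓ (disj (neg (disj (neg X) (neg (conjList M))))
      (neg (conj X (conjList M)))) := DD.comm L1 (by rw [dd_neg_neg]; exact h1.trans (by omega))
  -- `(¬X ∨ ¬⋀M) ∨ ⋀M`
  have L3 : ∃ B ℓ, BD 6 B ℓ (disj (disj (neg X) (neg (conjList M))) (conjList M)) := by
    refine DD.assoc (DD.expan (neg X) (DD.ax (conjList M) ?_) ?_)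
    · rw [dd_disj]; exact max_le (h2.trans (by omega)) (h4.trans (by omega))
    · rw [dd_disj, dd_disj]
      exact max_le (h3.trans (by omega)) (max_le (h2.trans (by omega)) (h4.trans (by omega)))
  have L4 : ∃ B ℓ, BD 6 B ℓ (disj (neg (neg (disj (neg X) (neg (conjList M))))) (conjList M)) := by
    refine DD.negNeg L3 ?_ (h2.trans (by omega))
    rw [dd_neg, altDepthAux_one_disj]
    omega
  exact DD.cut L2 L4

/-- **Conjunction elimination at disjunct depth `6`**: `⊢ ¬⋀M ∨ A` for every member `A` of a list
`M` of formulas of disjunct depth `≤ 1` (e.g. clause formulas) — walk down the spine with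
`conjExtract_tail`, finish with `conjExtract_head`. [Shoenfield 1967, §3.1] [folklore] -/
theorem conjExtract (hM : ∀ Y ∈ M, Y.dd ≤ 1) (hA : A ∈ M) :
    ∃ B ℓ, BD 6 B ℓ (disj (neg (conjList M)) A) := by
  induction M with
  | nil => simp at hA
  | cons X M ih =>
    have hX : X.dd ≤ 1 := hM X List.mem_cons_self
    have hM' : ∀ Y ∈ M, Y.dd ≤ 1 := fun Y hY => hM Y (List.mem_cons_of_mem _ hY)
    rw [conjList_cons]
    by_cases hAX : A = X
    · subst hAX
      exact conjExtract_head hX hM'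
    · have hA' : A ∈ M := by
        rcases List.mem_cons.1 hA with h | h
        · exact absurd h hAX
        · exact h
      have h1 : (neg (conjList (X :: M))).dd ≤ 4 := dd_neg_conjList_le_four hM
      rw [conjList_cons] at h1
      have T : ∃ B ℓ, BD 6 B ℓ (disj (conjList M) (neg (conj X (conjList M)))) :=
        DD.comm (conjExtract_tail hX hM') (by rw [dd_neg_neg]; exact h1.trans (by omega))
      exact DD.cut T (ih hM' hA')

end ConjExtract

/-! ### Node formulas of the decision tree -/

/-- The node formula `g₁ ∨ (g₂ ∨ ⋯ (g_k ∨ ¬Φ)) = G.foldr disj ¬Φ` of the decision tree: the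
literals falsified so far, most recent first, and the target `¬Φ` last (no `⊥` terminator).
Unfolding, empty list. [folklore] -/
theorem nodeForm_nil (Φ : PropForm ℕ) : List.foldr disj (neg Φ) [] = neg Φ := rfl

/-- Unfolding the node formula, one literal. [folklore] -/
theorem nodeForm_cons (Φ g : PropForm ℕ) (G : List (PropForm ℕ)) :
    List.foldr disj (neg Φ) (g :: G) = disj g (List.foldr disj (neg Φ) G) := rfl

section Nodes

variable {Φ : PropForm ℕ} {G : List (PropForm ℕ)} {g : PropForm ℕ}

/-- A node formula has disjunct depth `≤ 4`. [folklore] -/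
theorem dd_nodeForm_le (hΦ : (neg Φ).dd ≤ 4) (hG : ∀ g ∈ G, g.dd ≤ 1) :
    (G.foldr disj (neg Φ)).dd ≤ 4 := by
  induction G with
  | nil => simpa using hΦ
  | cons g G ih =>
    rw [nodeForm_cons, dd_disj, max_le_iff]
    exact ⟨(hG g List.mem_cons_self).trans (by omega),
      ih fun g' hg' => hG g' (List.mem_cons_of_mem _ hg')⟩

/-- A negated node formula has disjunct depth `≤ 6` (for `G = []` it is `¬¬Φ`, one block with
`¬Φ`). [folklore] -/
theorem dd_neg_nodeForm_le (hΦ : (neg Φ).dd ≤ 4) (hG : ∀ g ∈ G, g.dd ≤ 1) :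
    (neg (G.foldr disj (neg Φ))).dd ≤ 6 := by
  cases G with
  | nil => rw [nodeForm_nil, dd_neg_neg]; exact hΦ.trans (by omega)
  | cons g G => exact (dd_neg_le_dd_add_two _).trans (by have := dd_nodeForm_le hΦ hG; omega)

/-- **Member introduction for the target**: `⊢ ¬¬Φ ∨ N` for the node formula `N` (axiom
`¬¬Φ ∨ ¬Φ`, then the literals inserted by generalized expansion, each at cost
`dd ¬¬¬Φ = dd ¬Φ ≤ 4`). [Shoenfield 1967, §3.1, Lemma 2] [folklore] -/
theorem memberIntro_target (hΦ : (neg Φ).dd ≤ 4) (hG : ∀ g ∈ G, g.dd ≤ 1) :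
    ∃ B ℓ, BD 6 B ℓ (disj (neg (neg Φ)) (G.foldr disj (neg Φ))) := by
  induction G with
  | nil =>
    rw [nodeForm_nil]
    refine DD.ax (neg Φ) ?_
    rw [dd_disj, dd_neg_neg]
    exact max_le (hΦ.trans (by omega)) (hΦ.trans (by omega))
  | cons g G ih =>
    have hG' : ∀ g' ∈ G, g'.dd ≤ 1 := fun g' hg' => hG g' (List.mem_cons_of_mem _ hg')
    rw [nodeForm_cons]
    refine DD.genExp g (ih hG') ?_ ?_ ?_
    · rw [dd_neg_neg, dd_neg_neg]; exact hΦ.trans (by omega)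
    · have := dd_nodeForm_le hΦ hG'; omega
    · have := hG g List.mem_cons_self; omega

/-- **Member introduction for a literal**: `⊢ ¬g ∨ N` for every member `g` of the literal list of
the node formula `N`. [Shoenfield 1967, §3.1, Lemma 2] [folklore] -/
theorem memberIntro_lit (hΦ : (neg Φ).dd ≤ 4) (hG : ∀ g ∈ G, g.dd ≤ 1) (hg : g ∈ G) :
    ∃ B ℓ, BD 6 B ℓ (disj (neg g) (G.foldr disj (neg Φ))) := by
  induction G with
  | nil => simp at hg
  | cons g' G ih =>
    have hG' : ∀ x ∈ G, x.dd ≤ 1 := fun x hx => hG x (List.mem_cons_of_mem _ hx)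
    have hg'1 : g'.dd ≤ 1 := hG g' List.mem_cons_self
    have hN : (G.foldr disj (neg Φ)).dd ≤ 4 := dd_nodeForm_le hΦ hG'
    rw [nodeForm_cons]
    by_cases hgg : g = g'
    · subst hgg
      have hng : (neg g).dd ≤ 3 := (dd_neg_le_dd_add_two g).trans (by omega)
      refine DD.assoc' (DD.expan' (G.foldr disj (neg Φ)) (DD.ax g ?_) ?_) ?_ ?_ ?_
      · rw [dd_disj]; exact max_le (hng.trans (by omega)) (hg'1.trans (by omega))
      · exact dd_neg_nodeForm_le hΦ hG'
      · omega
      · omega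
      · omega
    · have hg2 : g ∈ G := by
        rcases List.mem_cons.1 hg with h | h
        · exact absurd h hgg
        · exact h
      refine DD.genExp g' (ih hG' hg2) ?_ ?_ ?_
      · rw [dd_neg_neg]
        exact (dd_neg_le_dd_add_two g).trans (by have := hG' g hg2; omega)
      · omega
      · omega

/-- **Absorbing a clause into the node formula**: if every literal of the clause `c` occurs in the
literal list of `N`, then `(c ∨ N) ⊢ N` — cut each literal against its member introduction
(`assoc'`, cut, `assoc'`, generalized contraction), finally remove the trailing `⊥`.
[Shoenfield 1967, §3.1, Lemma 2] [folklore] -/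
theorem absorb_clause (hΦ : (neg Φ).dd ≤ 4) (hG : ∀ g ∈ G, g.dd ≤ 1) :
    ∀ c : Clause ℕ, (∀ l ∈ c, litForm l ∈ G) →
      (∃ B ℓ, BD 6 B ℓ (disj (clauseForm c) (G.foldr disj (neg Φ)))) →
        ∃ B ℓ, BD 6 B ℓ (G.foldr disj (neg Φ))
  | [], _, h => by
    have h1 : ∃ B ℓ, BD 6 B ℓ (disj (G.foldr disj (neg Φ)) (const false)) :=
      DD.comm h (by simp)
    exact DD.removeBot h1 (dd_neg_nodeForm_le hΦ hG)
  | l :: c, hc, h => by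
    have hN : (G.foldr disj (neg Φ)).dd ≤ 4 := dd_nodeForm_le hΦ hG
    have hl : (litForm l).dd ≤ 1 := dd_litForm_le l
    have hcl : (clauseForm c).dd ≤ 1 := dd_clauseForm_le c
    rw [clauseForm_cons] at h
    have h1 : ∃ B ℓ, BD 6 B ℓ (disj (litForm l) (disj (clauseForm c) (G.foldr disj (neg Φ)))) :=
      DD.assoc' h (by omega) (by omega) (by omega)
    have h2 : ∃ B ℓ, BD 6 B ℓ
        (disj (disj (clauseForm c) (G.foldr disj (neg Φ))) (G.foldr disj (neg Φ))) :=
      DD.cut h1 (memberIntro_lit hΦ hG (hc l List.mem_cons_self))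
    have h3 : ∃ B ℓ, BD 6 B ℓ (disj (clauseForm c) (G.foldr disj (neg Φ))) :=
      DD.genCtn (DD.assoc' h2 (by omega) (by omega) (by omega)) (by omega) (by omega)
    exact absorb_clause hΦ hG c (fun l' hl' => hc l' (List.mem_cons_of_mem _ hl')) h3

/-- **Leaf step**: from `⊢ ¬Φ ∨ C` for a clause `C` all of whose literals occur in the literal
list of the node formula `N`, derive `N` (cut against `⊢ ¬¬Φ ∨ N`, then absorb the clause).
[Krajíček 1995, §4.3] [folklore] -/
theorem leaf_of_clause (hΦ : (neg Φ).dd ≤ 4) (hG : ∀ g ∈ G, g.dd ≤ 1) {c : Clause ℕ}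
    (hc : ∀ l ∈ c, litForm l ∈ G) (h : ∃ B ℓ, BD 6 B ℓ (disj (neg Φ) (clauseForm c))) :
    ∃ B ℓ, BD 6 B ℓ (G.foldr disj (neg Φ)) :=
  absorb_clause hΦ hG c hc (DD.cut h (memberIntro_target hΦ hG))

end Nodes

end Summit.PneNP.PneNP.Theorems
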